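import Summits.QuantumAdvantage.QuantumAdvantage.Theorems.SosSandwichPseudoBoundedAAClassicalCorner
import Summits.QuantumAdvantage.QuantumAdvantage.Theorems.SosSandwichPseudoBoundedAABooleanCorner
import HarnessLib

/-!
# Crux `PseudoBoundedAA` (stmt-QuantumAdvantage-15237, route SosSandwich) — the ROBUST classical corner:
# a polynomial `L²`-simulated by a shallow randomized classical algorithm has an influential variable

File 3 of the CLASSICAL CORNER of PB-AA (files 1–2: `SosSandwichPseudoBoundedAAClassicalCorner.lean` — mixtures of
decision trees have influential variables, `16·Var² ≤ D̄²·maxInf`; `…ClassicalCornerPMF.lean` — `PMF` vocabulary;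
file 4 `…ClassicalCornerDequantization.lean` — the kernel equivalence PB-AA ⟺ randomized shallow approximation).
Route-independent (no `Theses` import).

* `exists_influence_ge_of_near_mixture` — **the ROBUST classical corner** (pure two-function OSSS, no hypothesis on `p`):
  if ANY real polynomial `p` is within a quarter of its variance, in `L²`, of the acceptance probability
  `x ↦ Σ_k w_k·[t_k accepts x]` of a finite mixture of decision trees (`w_k ≥ 0`), then some variable has
  `4·Var[p]² ≤ D̄²·Infⱼ[p]`, `D̄ = Σ_k w_k·depth(t_k)` (`Cov[acc, p] ≥ Var[p]/2` by Cauchy–Schwarz — the tree's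
  `BooleanCorner.half_var_le_sum_centered_mul` — and `Cov[acc, p] ≤ D̄·√(maxⱼ Infⱼ[p])/4` by `osss_mixture`).
  In words: a polynomial that is `L²`-SIMULATED by a shallow randomized classical algorithm has an influential variable —
  the converse direction of the Aaronson–Ambainis programme (there: influential variables ⟹ classical simulation);
* `exists_influence_ge_of_near_mixture_depth_le` — depth form `4·Var[p]² ≤ D²·Infⱼ[p]` (weights summing to `≤ 1`,
  depths `≤ D`).

Honest label: robust form of a folklore-strength corner; no stub, crux or summit is closed.  Sources: O'Donnell–Saks–
Schramm–Servedio, FOCS 2005, Thm 3.2 and the display after it; Aaronson–Ambainis arXiv:0911.0996 Conj. 6 / Thm 8.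
-/

set_option linter.dupNamespace false

noncomputable section

namespace Summit.QuantumAdvantage.QuantumAdvantage.Theorems.SosSandwich

open Finset Function
open Literature.Computability.Complexity Literature.Computability.QuantumComplexity

namespace ClassicalCorner

variable {N : ℕ}

/-! ### The robust classical corner -/

/-- **Robust classical corner (pure OSSS).** For ANY real polynomial `p` and ANY finite mixture of decision trees
(`w_k ≥ 0`) whose acceptance probability `acc(x) = Σ_k w_k·[t_k accepts x]` `L²`-approximates `p` to a quarter of the
variance — `4·E(p − acc)² ≤ Var[p]` — some variable has `4·Var[p]² ≤ D̄²·Infⱼ[p]`, `D̄ = Σ_k w_k·depth(t_k)`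
(`Cov[acc, p] ≥ Var[p]/2` by Cauchy–Schwarz, `Cov[acc, p] ≤ D̄·√(maxⱼ Infⱼ[p])/4` by `osss_mixture`).
[cite: OdonnellEtAl2005, Thm 3.2] -/
theorem exists_influence_ge_of_near_mixture {ι : Type*} (s : Finset ι) (w : ι → ℝ) (hw : ∀ k ∈ s, 0 ≤ w k)
    (t : ι → DecisionTree N) (p : MvPolynomial (Fin N) ℝ)
    (happrox : 4 * boolAvg (fun x => (evalBool p x -
        ∑ k ∈ s, w k * (if (t k).eval x = true then (1 : ℝ) else 0)) ^ 2) ≤ boolVariance p)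
    (hv : 0 < boolVariance p) :
    ∃ j : Fin N, 4 * boolVariance p ^ 2 ≤ (∑ k ∈ s, w k * ((t k).depth : ℝ)) ^ 2 * influence j p := by
  classical
  rcases Nat.eq_zero_or_pos N with hN0 | hNpos
  · subst hN0
    exact absurd (BooleanCorner.boolVariance_fin_zero p) (ne_of_gt hv)
  have hne : (Finset.univ : Finset (Fin N)).Nonempty := ⟨⟨0, hNpos⟩, Finset.mem_univ _⟩
  obtain ⟨j, -, hj⟩ := Finset.exists_max_image Finset.univ (fun j => influence j p) hne
  refine ⟨j, ?_⟩
  set g : (Fin N → Bool) → ℝ := evalBool p with hgdef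
  set F : (Fin N → Bool) → ℝ := fun x => ∑ k ∈ s, w k * (if (t k).eval x = true then (1 : ℝ) else 0) with hFdef
  set C : ℝ := (2 : ℝ) ^ N with hCdef
  have hC : 0 < C := by rw [hCdef]; positivity
  have hIj := influence_nonneg j p
  set I : ℝ := influence j p with hIdef
  set Dbar : ℝ := ∑ k ∈ s, w k * ((t k).depth : ℝ) with hDdef
  have hDbar0 : 0 ≤ Dbar := Finset.sum_nonneg fun k hk => mul_nonneg (hw k hk) (Nat.cast_nonneg _)
  -- `L¹` increments of `g` are at most `C √I`
  have hM : ∀ j' : Fin N, ∑ x, |g (update x j' true) - g (update x j' false)| ≤ C * Real.sqrt I := fun j' =>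
    (sum_abs_update_le_sqrt_influence p j').trans
      (mul_le_mul_of_nonneg_left (Real.sqrt_le_sqrt (hj j' (Finset.mem_univ _))) hC.le)
  have key := osss_mixture s w hw t F g (fun x => rfl) (C * Real.sqrt I) (by positivity) hM
  -- the left-hand side of OSSS is `C · Σ (F − μ)(g − μ)` with `μ` the mean of `g`
  set μ : ℝ := (∑ x, g x) / C with hμ
  have hcov : C * (∑ x, F x * g x) - (∑ x, F x) * (∑ x, g x) = C * ∑ x, (F x - μ) * (g x - μ) := by
    have hsum : ∑ x, (F x - μ) * (g x - μ)
        = (∑ x, F x * g x) - μ * (∑ x, F x) - μ * (∑ x, g x) + C * μ ^ 2 := by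
      have h : ∀ x, (F x - μ) * (g x - μ) = F x * g x - μ * F x - μ * g x + μ ^ 2 := fun x => by ring
      rw [Finset.sum_congr rfl fun x _ => h x, Finset.sum_add_distrib, Finset.sum_sub_distrib,
        Finset.sum_sub_distrib, ← Finset.mul_sum, ← Finset.mul_sum, Finset.sum_const, Finset.card_univ,
        BooleanCorner.card_cube_nat, nsmul_eq_mul, hCdef]
      push_cast; ring
    rw [hsum, hμ]
    field_simp
    ring
  -- `Σ (g − μ)² = C · Var[p]`
  have hVar : ∑ x, (g x - μ) ^ 2 = C * boolVariance p := by
    rw [hμ, hCdef, hgdef]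
    unfold boolVariance boolAvg
    rw [mul_div_cancel₀ _ (by positivity : (2 : ℝ) ^ N ≠ 0)]
  -- the approximation hypothesis in sum form
  have happrox' : 4 * ∑ x, (g x - F x) ^ 2 ≤ ∑ x, (g x - μ) ^ 2 := by
    rw [hVar]
    have h1 : boolAvg (fun x => (evalBool p x -
        ∑ k ∈ s, w k * (if (t k).eval x = true then (1 : ℝ) else 0)) ^ 2) = (∑ x, (g x - F x) ^ 2) / C := by
      rw [hCdef, hgdef, hFdef]; rfl
    rw [h1] at happrox
    have := mul_le_mul_of_nonneg_left happrox hC.le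
    rwa [← mul_assoc, mul_comm C 4, mul_assoc, mul_div_cancel₀ _ hC.ne'] at this
  have hhalf := BooleanCorner.half_var_le_sum_centered_mul F g μ happrox'
  rw [hcov] at key
  rw [hVar] at hhalf
  have h1 : C * (C * boolVariance p / 2) ≤ Dbar * C * (C * Real.sqrt I) / 4 :=
    (mul_le_mul_of_nonneg_left hhalf hC.le).trans key
  have h2 : boolVariance p ≤ Dbar * Real.sqrt I / 2 := by
    have h1' : C * C * boolVariance p ≤ C * C * (Dbar * Real.sqrt I / 2) := by
      calc C * C * boolVariance p = 2 * (C * (C * boolVariance p / 2)) := by ring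
        _ ≤ 2 * (Dbar * C * (C * Real.sqrt I) / 4) := by linarith
        _ = C * C * (Dbar * Real.sqrt I / 2) := by ring
    exact le_of_mul_le_mul_left h1' (by positivity)
  have hD0 : (0 : ℝ) ≤ Dbar * Real.sqrt I / 2 := by positivity
  calc 4 * boolVariance p ^ 2 ≤ 4 * (Dbar * Real.sqrt I / 2) ^ 2 := by
        have := pow_le_pow_left₀ hv.le h2 2
        linarith
    _ = Dbar ^ 2 * I := by rw [div_pow, mul_pow, Real.sq_sqrt hIj]; ring

/-- Depth form of the robust classical corner: weights summing to at most `1` and all depths `≤ D` give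
`4·Var[p]² ≤ D²·Infⱼ[p]`. [cite: OdonnellEtAl2005, Thm 3.2] -/
theorem exists_influence_ge_of_near_mixture_depth_le {ι : Type*} (s : Finset ι) (w : ι → ℝ)
    (hw : ∀ k ∈ s, 0 ≤ w k) (hw1 : ∑ k ∈ s, w k ≤ 1) (t : ι → DecisionTree N) (D : ℝ)
    (hD : ∀ k ∈ s, ((t k).depth : ℝ) ≤ D) (p : MvPolynomial (Fin N) ℝ)
    (happrox : 4 * boolAvg (fun x => (evalBool p x -
        ∑ k ∈ s, w k * (if (t k).eval x = true then (1 : ℝ) else 0)) ^ 2) ≤ boolVariance p)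
    (hv : 0 < boolVariance p) :
    ∃ j : Fin N, 4 * boolVariance p ^ 2 ≤ D ^ 2 * influence j p := by
  obtain ⟨j, hj⟩ := exists_influence_ge_of_near_mixture s w hw t p happrox hv
  refine ⟨j, hj.trans ?_⟩
  have hI := influence_nonneg j p
  have hDbar0 : 0 ≤ ∑ k ∈ s, w k * ((t k).depth : ℝ) :=
    Finset.sum_nonneg fun k hk => mul_nonneg (hw k hk) (Nat.cast_nonneg _)
  have hD0 : 0 ≤ D := by
    rcases s.eq_empty_or_nonempty with hs | ⟨k, hk⟩
    · -- no trees: the mixture is `0`, and `4 E p² ≤ Var p ≤ E p²`-type degeneracy still leaves `D` free; use `Dbar = 0`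
      subst hs
      simp only [Finset.sum_empty] at hj
      -- `4 Var² ≤ 0` contradicts `Var > 0`
      nlinarith [hj, hv]
    · exact (Nat.cast_nonneg _).trans (hD k hk)
  have hDbar : ∑ k ∈ s, w k * ((t k).depth : ℝ) ≤ D := by
    calc ∑ k ∈ s, w k * ((t k).depth : ℝ) ≤ ∑ k ∈ s, w k * D :=
          Finset.sum_le_sum fun k hk => mul_le_mul_of_nonneg_left (hD k hk) (hw k hk)
      _ = (∑ k ∈ s, w k) * D := by rw [Finset.sum_mul]
      _ ≤ 1 * D := by gcongr
      _ = D := one_mul _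
  gcongr

end ClassicalCorner

end Summit.QuantumAdvantage.QuantumAdvantage.Theorems.SosSandwich

end
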